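import Summits.Ventures.CertifiedManyBodySolver.Theorems.M3x2EdgeSplitSymReplayOutRoutePF
import HarnessLib

/-!
# SymReplay checker — PACKED EMISSION for the hierarchical enumerator («γ-lite»): products are emitted as packed words

(team lb-sym, cell hub-lb; hub-lb-sym-eng-3 g3.  ADDITIVE on `…OutRouteM` / `…OutRouteMF` / `…OutRoutePF` / `…PackedNF`;
nothing landed is touched; crit-1 V172 successor-lever order, item (γ), cheap half.)

WHY (a replay-COST lever, measured).  The E-class module grammar of record evaluates
`PackedNF.pisZero (PackedNF.pcanonNFZHBZ lo hi oP (PackedNF.encP lo hi (shareRFastMF …)))`: the share is enumerated on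
`Word`s and then ENCODED product by product (`encP` = `siteRank` arithmetic on every letter of every emitted product) —
19 µs per product on the farm (hub-lb-sym-eng-3 g3 `CLenBench`, three arms 18.8/19.1/19.0 µs), i.e. ≈ 19 % of the measured
all-in module cost at E₁ (≈ 100 µs per product).  But every product word is `u† ++ w` for a REPRESENTATIVE term `u†` and a
generated BASIS word `w`, and `encW` is a `List.map`: `encW (u† ++ w) = encW u† ++ encW w`.  So the representative term is
encoded ONCE (outside the target loop) and every basis word ONCE (in a packed-tagged bucket map built next to `bucketOf`),
and the product is emitted directly as `(coef, encW u† ++ encW w)` — no per-product letter arithmetic.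

CONTENTS.  `bucketOfP` (bucket map whose entries carry the packed basis word) with `bucketOfP_getD` (= `bucketOf_getD`, tagged);
`rowFastFP` / `shareRWithMFP` / **`shareRFastMFP S K gbs hm κ₂ lo hi J L i f : PPoly`**; the LIST bridge
**`shareRFastMFP_eq : shareRFastMFP … = PackedNF.encP lo hi (shareRFastMF S K gbs hm κ₂ J L i f)`** (pure `List.map`
commutation); fact transport `OutFactsP0.of_packedEmission`.  NO new closing theorem is needed: the bare packed fact of
`…OutRoutePF` for module `m` is OBTAINED from the cheaper evaluation by
`theorem out_m : PackedNF.pisZero (PackedNF.pcanonNFZHBZ lo hi oP (PackedNF.encP lo hi (shareRFastMF Sm K gbs hm κ₂ J L (m / L)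
(m % L)))) = true := by rw [← shareRFastMFP_eq]; native_decide`, and `energyDensity_ge_of_outroutePMF0` closes as before
(likewise sym-eng-4's `…PMFZ0` once the same three-line change is made to `rowFastFZ`).  Standard axioms; no `native_decide`
in this file.

HONEST FRAMING: a refinement between two executables (checker COST); no certificate lands by this file; no bound of record
moves (#529 −0.8295699476 outside Lean; tree floor −0.8942613047 computational; stmt-Ventures-22024 met BY VALUE only,
un-landed; stmt-Ventures-21721 open); no summit or crux statement is proved here; nothing here predicts superconductivity.
-/

namespace Summit.Ventures.CertifiedManyBodySolver.Theorems.SymReplay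

open Literature.Probability.LatticeModels

section PackedEmission

variable {M : Type} [DecidableEq M] [Hashable M]

/-- Tag a bucket entry `(L_j, (c, w))` with the packed basis word `encW lo hi w`. -/
def ptag (lo hi : ℤ × ℤ) (x : List (ℚ × ℕ) × (ℚ × Word)) : (List (ℚ × ℕ) × (ℚ × Word)) × PackedNF.PWord :=
  (x, PackedNF.encW lo hi x.2.2)

/-- **Packed-tagged bucket map**: the block's tagged basis terms bucketed by moment (as `bucketOf`), each entry carrying
its packed word — every basis word is encoded ONCE per block here. -/
def bucketOfP (S : MomSpec M) (lo hi : ℤ × ℤ) (xs : List (List (ℚ × ℕ) × (ℚ × Word))) :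
    Std.HashMap M (List ((List (ℚ × ℕ) × (ℚ × Word)) × PackedNF.PWord)) :=
  xs.foldl (fun mp x => mp.insert (mom S x.2.2) (ptag lo hi x :: mp.getD (mom S x.2.2) [])) ∅

/-- The fold behind `bucketOfP`, from an arbitrary start map (invariant proof, as `bucketOf_foldl_getD`). -/
theorem bucketOfP_foldl_getD (S : MomSpec M) (lo hi : ℤ × ℤ) (xs : List (List (ℚ × ℕ) × (ℚ × Word))) :
    ∀ (mp : Std.HashMap M (List ((List (ℚ × ℕ) × (ℚ × Word)) × PackedNF.PWord)))
      (pre : List (List (ℚ × ℕ) × (ℚ × Word))),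
      (∀ m, mp.getD m [] = ((pre.filter fun x => decide (mom S x.2.2 = m)).reverse.map (ptag lo hi))) →
      ∀ m, (xs.foldl (fun mp x => mp.insert (mom S x.2.2) (ptag lo hi x :: mp.getD (mom S x.2.2) [])) mp).getD m [] =
        (((pre ++ xs).filter fun x => decide (mom S x.2.2 = m)).reverse.map (ptag lo hi)) := by
  induction xs with
  | nil => intro mp pre h m; rw [List.foldl_nil, List.append_nil]; exact h m
  | cons x xs ih =>
    intro mp pre h m
    rw [List.foldl_cons, show pre ++ x :: xs = pre ++ [x] ++ xs by simp]
    refine ih _ (pre ++ [x]) (fun m' => ?_) m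
    rw [Std.HashMap.getD_insert, List.filter_append, List.reverse_append, List.map_append]
    by_cases hx : mom S x.2.2 = m'
    · subst hx
      simp [h]
    · simp [h, hx]

/-- **Packed bucket `m` = the tagged terms of moment `m`** (reversed) — i.e. `bucketOf`'s bucket, entrywise tagged. -/
theorem bucketOfP_getD (S : MomSpec M) (lo hi : ℤ × ℤ) (xs : List (List (ℚ × ℕ) × (ℚ × Word))) (m : M) :
    (bucketOfP S lo hi xs).getD m [] = ((bucketOf S xs).getD m []).map (ptag lo hi) := by
  rw [bucketOf_getD]
  have h := bucketOfP_foldl_getD S lo hi xs ∅ [] (fun m => by simp) m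
  rwa [List.nil_append] at h

/-- **One representative row, packed emission**: the representative term is encoded once (`tP`), the basis word's code is
read from the tagged bucket, the product is emitted as `(coef, tP ++ xP)`; the secondary test `P₂` and the dot are exactly
`rowFastF`'s (`stepOpt`). -/
def rowFastFP (S : MomSpec M) (lo hi : ℤ × ℤ) (a : QPoly × List (ℚ × ℕ))
    (wmapP : Std.HashMap M (List ((List (ℚ × ℕ) × (ℚ × Word)) × PackedNF.PWord))) (m s : ℚ) (T : List M)
    (P₂ : Word → Bool) : PackedNF.PPoly :=
  (padj a.1).flatMap fun t =>
    let tP := PackedNF.encW lo hi t.2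
    T.flatMap fun mt =>
      (wmapP.getD (S.sub mt (mom S t.2)) []).filterMap fun xp =>
        if P₂ (t.2 ++ xp.1.2.2) then (stepOpt a m s t xp.1).map fun r => (r.1, tP ++ xp.2) else none

/-- R-part of sub-module `(i, f)`, packed emission (one tagged bucket map per block). -/
def shareRWithMFP (S : MomSpec M) (lo hi : ℤ × ℤ) (K : SymCertR) (gbs : List (List QPoly)) (T : List M)
    (P₂ : Word → Bool) : PackedNF.PPoly :=
  (K.gramR.zip gbs).flatMap fun Bg =>
    let wmapP := bucketOfP S lo hi (wflat (Bg.2.zip Bg.1.rows))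
    (Bg.1.reps.zip Bg.1.rows).flatMap fun a => rowFastFP S lo hi a wmapP Bg.1.moves.length Bg.1.scale T P₂

/-- **Sub-module `(i, f)`'s share, PACKED at emission** (base and `gramM` parts — small — are encoded as lists). -/
def shareRFastMFP (S : MomSpec M) (K : SymCertR) (gbs : List (List QPoly)) (hm : MomTable M) (κ₂ : Word → ℕ)
    (lo hi : ℤ × ℤ) (J L i f : ℕ) : PackedNF.PPoly :=
  let P := wordPred (inSlotW (momKey S hm) J i)
  let P₂ : Word → Bool := fun w => κ₂ w % L == f
  PackedNF.encP lo hi ((baseShareF K.toSymCert P).filter (wordPred P₂)) ++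
  (PackedNF.encP lo hi ((pscale (-1) (K.gramM.flatMap fun B => (gramBlockPoly B).filter P)).filter (wordPred P₂)) ++
    shareRWithMFP S lo hi K gbs (targetsM hm J i) P₂)

/-- `stepOpt` emits the word `t.2 ++ x.2.2`: mapping its result through the term encoder = re-pairing the coefficient
with the concatenated codes. -/
theorem stepOpt_map_enc (lo hi : ℤ × ℤ) (a : QPoly × List (ℚ × ℕ)) (m s : ℚ) (t : ℚ × Word)
    (x : List (ℚ × ℕ) × (ℚ × Word)) :
    (stepOpt a m s t x).map (fun r => (r.1, PackedNF.encW lo hi r.2)) =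
      (stepOpt a m s t x).map (fun r => (r.1, PackedNF.encW lo hi t.2 ++ PackedNF.encW lo hi x.2.2)) := by
  unfold stepOpt
  split
  · rfl
  · simp [PackedNF.encW, List.map_append]

/-- **Row bridge**: on a tagged bucket map, packed emission = encoding `rowFastF`'s output. -/
theorem rowFastFP_eq (S : MomSpec M) (lo hi : ℤ × ℤ) (a : QPoly × List (ℚ × ℕ))
    (wmap : Std.HashMap M (List (List (ℚ × ℕ) × (ℚ × Word))))
    (wmapP : Std.HashMap M (List ((List (ℚ × ℕ) × (ℚ × Word)) × PackedNF.PWord)))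
    (hW : ∀ k, wmapP.getD k [] = (wmap.getD k []).map (ptag lo hi)) (m s : ℚ) (T : List M) (P₂ : Word → Bool) :
    rowFastFP S lo hi a wmapP m s T P₂ = PackedNF.encP lo hi (rowFastF S a wmap m s T P₂) := by
  simp only [rowFastFP, rowFastF, PackedNF.encP, List.map_flatMap, hW, List.filterMap_map, List.map_filterMap]
  congr 1; funext t; congr 1; funext mt; congr 1; funext x
  simp only [Function.comp_def, ptag]
  by_cases hc : P₂ (t.2 ++ x.2.2)
  · simp only [hc, if_true]; exact (stepOpt_map_enc lo hi a m s t x).symm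
  · simp only [hc]; rfl

/-- **Block bridge**: packed emission over all R-blocks = encoding `shareRWithMF`'s output. -/
theorem shareRWithMFP_eq (S : MomSpec M) (lo hi : ℤ × ℤ) (K : SymCertR) (gbs : List (List QPoly)) (T : List M)
    (P₂ : Word → Bool) :
    shareRWithMFP S lo hi K gbs T P₂ = PackedNF.encP lo hi (shareRWithMF S K gbs T P₂) := by
  simp only [shareRWithMFP, shareRWithMF, PackedNF.encP, List.map_flatMap]
  congr 1; funext Bg; congr 1; funext a
  exact rowFastFP_eq S lo hi a _ _ (bucketOfP_getD S lo hi _) _ _ T P₂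

/-- **THE BRIDGE**: the packed-emission share IS the term-encoded share of record (list equality, no hypothesis). -/
theorem shareRFastMFP_eq (S : MomSpec M) (K : SymCertR) (gbs : List (List QPoly)) (hm : MomTable M) (κ₂ : Word → ℕ)
    (lo hi : ℤ × ℤ) (J L i f : ℕ) :
    shareRFastMFP S K gbs hm κ₂ lo hi J L i f = PackedNF.encP lo hi (shareRFastMF S K gbs hm κ₂ J L i f) := by
  simp only [shareRFastMFP, shareRFastMF, PackedNF.encP_append, shareRWithMFP_eq]

/-- **Fact transport**: bare packed facts evaluated on the packed-emission shares ARE the `OutFactsP0` facts of the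
term-encoded shares (for the closings `energyDensity_ge_of_outroutePMF0` / `…PS0`). -/
theorem OutFactsP0.of_packedEmission {lo hi : ℤ × ℤ} {oP : PackedNF.PWord → PackedNF.PHint} {S : ℕ → QPoly}
    {SP : ℕ → PackedNF.PPoly} (hSP : ∀ m, SP m = PackedNF.encP lo hi (S m)) :
    ∀ (n i : ℕ), (∀ m, i ≤ m → m < i + n → PackedNF.pisZero (PackedNF.pcanonNFZHBZ lo hi oP (SP m)) = true) →
      OutFactsP0 lo hi oP S i n
  | 0, _, _ => trivial
  | n + 1, i, h =>
    ⟨by rw [← hSP]; exact h i le_rfl (by omega),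
     OutFactsP0.of_packedEmission hSP n (i + 1) fun m hm hm' => h m (by omega) (by omega)⟩

/-- **Module grammar (packed emission)**, as a closing corollary of `energyDensity_ge_of_outroutePMF0`: per module
`m < J·L` the producer evaluates `PackedNF.pisZero (PackedNF.pcanonNFZHBZ lo hi oP (shareRFastMFP Sm K (K.gramR.map genBasis) hm κ₂
lo hi J L (m / L) (m % L))) = true` (by `native_decide`), nothing else changes. -/
theorem energyDensity_ge_of_outroutePMFP {Mo : Type} [DecidableEq Mo] [Hashable Mo] (Sm : MomSpec Mo) (K : SymCertR)
    (hwf : wellFormed K.expand = true) (hRok : K.gramR.all (gramBlockROK K.frame) = true)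
    (oP : PackedNF.PWord → PackedNF.PHint) (hm : MomTable Mo) (κ₂ : Word → ℕ) (J L : ℕ) (hJ : 0 < J) (hL : 0 < L)
    (lo hi : ℤ × ℤ) (hbox : boxLicence K.frame lo hi = true) (hcov : coverM Sm K (K.gramR.map genBasis) hm = true)
    (hfacts : ∀ m, m < J * L → PackedNF.pisZero (PackedNF.pcanonNFZHBZ lo hi oP
      (shareRFastMFP Sm K (K.gramR.map genBasis) hm κ₂ lo hi J L (m / L) (m % L))) = true) :
    ((symValueR K : ℚ) : ℝ) ≤ Literature.MathematicalPhysics.QuantumLattice.ThermodynamicLimit.energyDensityTT' 1 0 8 (7 / 8) :=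
  energyDensity_ge_of_outroutePMF0 Sm K hwf hRok oP hm κ₂ J L hJ hL lo hi hbox hcov
    (OutFactsP0.of_packedEmission (fun m => shareRFastMFP_eq Sm K _ hm κ₂ lo hi J L (m / L) (m % L)) (J * L) 0
      fun m _ hm' => hfacts m (by omega))

end PackedEmission

end Summit.Ventures.CertifiedManyBodySolver.Theorems.SymReplay
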